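import Literature.MathematicalPhysics.QuantumFieldTheory.Balaban1983to89.B9Eq321LandauProjectionZdPer
import Literature.MathematicalPhysics.QuantumFieldTheory.Balaban1983to89.B9Eq327GreenZdHermPer

/-!
# `Balaban1983to89.B9Eq321LandauOrthogonalZdPer` — [Balaban1985RegularSpaces] (1.38) ∕ (1.42) pp. 82–83 with [Balaban1985BackgroundPropagators]
# (3.19)–(3.23) pp. 393–394 ON THE TORUS `T_P` READ ON `ℤᵈ`: the MULTIPLIER FORM of the Landau gauge condition at `Ω₀ = ℤᵈ`
# (`B8Eq138LandauZd.IsLandau138 L m η Set.univ Λs U₀ A`: «Δ^η_{U₀}D^{η*}_{U₀}A = Q′(U₀)ᵀμ») at `P`-PERIODIC data IMPLIES print's ORTHOGONALITY FORM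
# «R(U₀)D^{η*}_{U₀}A = 0» in `L²(T_P, 𝔤)`: `D^{η*}_{U₀}A ⊥ Δ^η_{U₀}N^per(Q′(U₀))` over the period cell `[0,P)ᵈ`, hence
# `projEPer … (D^{η*}_{U₀}A) = 0` and `projRPer … (D^{η*}_{U₀}A) = 0` for the periodic projection of `B9Eq321LandauProjectionZdPer` — the periodic twin of
# `B9Eq321LandauOrthogonalZd` (finite `Ω₀`, Dirichlet reading) and of `B9Eq321LandauProjectionZd` §4

statement-level skeleton of published theorems with citation tags; proofs where landed; nothing here is a claim about the
Yang–Mills mass gap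

`[Balaban1985BackgroundPropagators]` ("B9", CMP **99** (1985) 389–434) p. 394: *«R = R(U) is an orthogonal projection in the Hilbert space L²(Ω₀, g)
onto the subspace R = Δ^η_U N(Q′), N(Q′) = {λ : Q′λ = 0}. (3.21)»*, *«Δ^η_U = D^{η*}_U D^η_U (3.23)»*, (3.19) p. 393 (the averaging `Q′_j(U)` with the
transporters `R(U(Γ))`), p. 391 *«The adjoints are taken with respect to natural L² scalar products … X·Y = tr XY»*; `[Balaban1985RegularSpaces]` ("B8",
CMP **99** (1985) 75–102) p. 77 *«Let us consider a sequence of domains Ω₀ ⊃ Ω₁ ⊃ … we admit the case when some domains Ω_j are equal to T_η»*,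
(1.1) p. 76 (the two covariant derivatives), (1.38) p. 82 *«R(U₀)D^{η*}_{U₀}A = 0»*, (1.42) p. 83.  PDF held: `paper:balaban1985-cmp99-background-propagators`
pp. 391–395; `paper:balaban1985-cmp99-regular-spaces-gauge-fixing` pp. 76–83.

CITATION HEADER (lean-in-tree rule).  Cell `pub-ymgap` (YM Track A, HUMAN RULING D-0062 ∕ D-0149 width push), DAG node N06 = [B9], width seat
`pub-ymgap-dag-n06-w4` (g6), the (β′-PERIODIC) road of director-ym №217 (1) ∕ plan g86 PENS-217.  WHY: N05's family index forces `Ω 0 = univ`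
(`B8LeafModelZd3.zdGF3` ∕ the periodic member model `B8LeafModelZdPer.zdGF3Per` KEEP the Landau predicate of record `IsLandau138 L m η (i.Ω 0) (i.Λs m) U₀ A`
with `i.Ω 0 = univ`), while the Dirichlet objects of N06 (`projE`, `opsLandau`, `landauAt_opsLandau`) need `(Ω 0).Finite`.  On the periodic road the
finite-dimensionality comes from periodicity (`B9Eq321LandauProjectionZdPer.perSub ∕ projEPer`, this seat g5; the periodic Green letter
`B9Eq327GreenZdHermPer`, seat dag-n06-b g22), and the genuine periodic letter record `opsLandauPer` (`DRDs := D^η_{U₀}·projRPer·D^{η*}_{U₀}`, dag-n06-b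
CLAIM-3) needs exactly the fact typed here: the Landau condition of record at `Ω₀ = univ` puts `D^{η*}_{U₀}A` in the kernel of the periodic projection.
Nothing is re-declared: the cell sums `Σ_{x ∈ [0,P)ᵈ}` (`T4TermwiseTorus.box`), the periodic summation by parts `B9Eq327GreenZdHermPer.sum_box_pair_covDerivFwd`,
the stencils `covLap ∕ covDivB ∕ qprimeT1 ∕ QprimeT ∕ QT ∕ QprimeIter ∕ bgT` and the projection `projEPer ∕ projRPer` are imported BY NAME.

WHAT IS PROVED (kernel, 0 sorry; theorems only — no `def`, no `instance`, no `notation`).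
* §1 (cell tiling) `mem_box_mul_iff_blockMap_mem_box` (`x ∈ [0,LQ)ᵈ ⟺ ⌊x∕L⌋ ∈ [0,Q)ᵈ`), ★ `box_mul_eq_biUnion_blockSites`
  (`[0,LQ)ᵈ = ⨆_{y ∈ [0,Q)ᵈ} B(y)`, the blocks `B(y) = {Ly + t : 0 ≤ t < L}`), `box_eq_biUnion_blockSites_of_dvd` (`L ∣ P`), `box_div_pow_eq_biUnion_blockSites`
  (`Lʲ⁺¹ ∣ P`: the level-`j` cell `[0,P∕Lʲ)ᵈ` is tiled by the blocks of the level-`(j+1)` cell), `pairwiseDisjoint_blockSites`.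
* §2 (block transposes ON THE CELL, (3.19)) ★ `sum_box_pair_qprimeT1` (one step: `Σ_{x∈[0,P)ᵈ} B(g(x), (Q′ᵀν)(x)) = Σ_{z∈[0,P∕L)ᵈ} B((Q′g)(z), ν(z))`,
  `L ∣ P`), ★★ `sum_box_pair_QprimeT` (iterated: `Σ_{x∈[0,P)ᵈ} B(g(x), (Q′_jᵀν)(x)) = Σ_{y∈[0,P∕Lʲ)ᵈ} B((Q′_j(U₀)g)(y), ν(y))`, `Lʲ ∣ P`),
  `sum_box_pair_QT` (the level sum, `Lᵐ ∣ P`) — for every pairing `B` invariant under a subgroup `S ∋ Ū₀ʲ(Γ_{z,y})`; NO periodicity of `g`, `ν`, `μ` is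
  needed: the identity is block-local and the cells are exactly tiled.
* §3 (`Δ^η_{U₀}` on the torus) `sum_box_pair_covLap_eq_sum` (`Σ_cell B(g, Δ^η_{U₀}f) = Σ_μ Σ_cell B(D^η_μ g, D^η_μ f)` for periodic `U₀, f, g` —
  two calls of dag-n06-b's `sum_box_pair_covDerivFwd`), ★ `sum_box_pair_covLap_symm` (`Δ^η_{U₀}` is `B`-symmetric on `L²(T_P, ·)`).
* §4 (multiplier ⟹ orthogonality on the torus) ★★ `sum_box_pair_covLap_eq_zero_of_multiplier` (the core identity: `Δ^η_{U₀}φ = Q′(U₀)ᵀμ` on the cell,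
  `φ, λ, U₀` periodic, `Lᵐ ∣ P`, `Q′_j(U₀)λ = 0` on `Λ_j` (`j ≤ m`) ⟹ `Σ_{x∈[0,P)ᵈ} B((Δ^η_{U₀}λ)(x), φ(x)) = 0`),
  ★★ `sum_box_pair_covLap_covDivB_eq_zero_of_isLandau138` (`IsLandau138 L m η Set.univ Λs U₀ A` at periodic `U₀, A`), `…_units` (`S = ⊤`: EVERY periodic
  background of units), ★ `sum_box_trace_covLap_mul_covDivB_eq_zero_of_isLandau138` (the tracial pairing `τ(ab)` of p. 391).
* §5 (the equation for the constructed projection) ★★ `covDivB_mem_orthogonal_rangeSubPer` (`D^{η*}_{U₀}A ∈ (Δ^η_{U₀}N_𝔤^per(Q′(U₀)))^⊥` in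
  `L²(T_P, ·)` for the pairing `formPer τ P`, `U₀` unitary periodic, `τ` tracial), ★★★ `projEPer_covDivB_eq_zero_of_isLandau138`,
  ★★★ `projRPer_covDivB_eq_zero_of_isLandau138` («R(U₀)D^{η*}_{U₀}A = 0» on `T_P` AS AN EQUATION for `projRPer`: faithful Hermitian tracial `τ`,
  finite-dimensional fibre), `covDerivFwd_projRPer_covDivB_eq_zero_of_isLandau138` (the `DRD*` letter `D^η_{U₀}R(U₀)D^{η*}_{U₀}A` vanishes identically).
* §6 A6 ∕ non-vacuity: `projRPer_covDivB_eq_zero_of_isLandau138_complex` (abelian fibre `𝔸 = ℂ`, `τ = id`: the three `τ`-hypotheses discharged),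
  `isLandau138_univ_zero_periodic` (the hypotheses of §5 are jointly inhabited: `A = 0`, any periodic unitary `U₀`) and `isLandau138_univ_const_one`
  (a NON-ZERO inhabitant: the constant fields at `U₀ = 1`).

HONEST SCOPE.  (i) Lattice bookkeeping on the period cell (summation by parts on the torus + block transposes); NO estimate of [B9] ∕ [B8] is proved;
(3.24) ∕ Thm 3.1 ∕ Thm 3.11 ∕ Thm 3.3 are NOT proved.  (ii) The divisibility `Lʲ ∣ P` (all `j ≤ m`, i.e. `Lᵐ ∣ P`) is print's: the torus `T_η` has side
`L^k·(unit)` and every block lattice divides it ([B8] p. 77); without it the level-`j` cell is not tiled by blocks and the transpose identity is not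
block-local.  (iii) The Landau text is the record's `IsLandau138` read at `Ω₀ = Set.univ` (`Set.univ.indicator = id`): the multiplier `μ` is NOT assumed
periodic (the proof never moves it).  (iv) Count-neutral; N05 ∕ N06 NOT discharged; K1⁹ `stmt-QuantumFields-27364` NOT closed; one finite `𝕋⁴` programme at
fixed `ε`, Bałaban as printed; R4 closes only the conditional finite-`𝕋⁴` rung `BalabanLadder.UV` — nothing continuum ∕ ℝ⁴ ∕ OS ∕ mass gap ∕ Clay.
Unit `pub-ymgap-dag-n06-w4` (g6), 2026-08-28.
-/

noncomputable section

namespace Literature.MathematicalPhysics.QuantumFieldTheory.Balaban1983to89.B9Eq321LandauOrthogonalZdPer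

open B7Prop1Explicit B7Eq78Linearization
open B7Prop2Explicit (unitaryUnits)
open B8Ineq132 (covDeriv covDerivFwd)
open B8Eq119TwistedAxial (bgT)
open B8Eq138LandauZd (covDivB covLap qprimeT1 QprimeT QT IsLandau138)
open Literature.MathematicalPhysics.QuantumLattice (blockMap blockSites mem_blockSites_iff)
open T4TermwiseTorus (IsPeriodic box mem_box tcls tlift)
open B9Eq321LandauProjectionZdPer (perSub formPer formPer_apply gaugeNullPer rangeSubPer projEPer projRPer perRestrict perRestrict_eq_self
  isPeriodic_covDivB projEPer_apply_of_mem_orthogonal)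
open B9Eq327GreenZdHermPer (sum_box_pair_covDerivFwd)

-- `Site` alone could resolve to the torus sites of `Setup.lean`; re-export the `ℤ^d` sites of `B7Prop1Explicit`.
export B7Prop1Explicit (Site)

variable {d : ℕ}

/-! ## §1  Cell tiling: `[0,LQ)ᵈ` is the disjoint union of the blocks `B(y)`, `y ∈ [0,Q)ᵈ` -/

section Tiling

/-- `x ∈ [0,LQ)ᵈ ⟺ ⌊x∕L⌋ ∈ [0,Q)ᵈ` (`L ≥ 1`; coordinatewise floor division: the block of a site of the fine cell is labelled by the coarse cell).
[cite: Balaban1985Averaging, (2)–(3) p.17 (the blocks `B(y)`); Balaban1985RegularSpaces, p.77 («Ω_j = T_η»)] -/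
theorem mem_box_mul_iff_blockMap_mem_box (L Q : ℕ) [NeZero L] (x : Site d) :
    x ∈ box (d := d) (L * Q) ↔ blockMap L x ∈ box (d := d) Q := by
  have hL : (0 : ℤ) < L := by exact_mod_cast Nat.pos_of_ne_zero (NeZero.ne L)
  rw [mem_box, mem_box]
  refine forall_congr' fun κ => ?_
  simp only [blockMap, Nat.cast_mul]
  rw [Int.ediv_nonneg_iff_of_pos hL, Int.ediv_lt_iff_lt_mul hL, mul_comm (Q : ℤ)]

/-- the blocks `B(y)` with distinct labels are disjoint (the blocks partition the lattice). [cite: Balaban1985Averaging, (2)–(3) p.17] -/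
theorem pairwiseDisjoint_blockSites (L : ℕ) [NeZero L] (s : Set (Site d)) : s.PairwiseDisjoint (blockSites L) := by
  intro y _ y' _ hne
  refine Finset.disjoint_left.mpr fun x hx hx' => hne ?_
  rw [mem_blockSites_iff] at hx hx'
  rw [← hx, ← hx']

/-- ★ **CELL TILING**: `[0,LQ)ᵈ = ⨆_{y ∈ [0,Q)ᵈ} B(y)` with `B(y) = {Ly + t : 0 ≤ t_i < L}` the blocks of the `L`-lattice ([B7] (2) p. 17 ∕ [B9] (3.19):
the blocks partition the fine lattice, and the blocks with labels in the coarse cell are exactly the fine cell). [cite: Balaban1985Averaging, (2)–(3) p.17] -/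
theorem box_mul_eq_biUnion_blockSites (L Q : ℕ) [NeZero L] :
    box (d := d) (L * Q) = (box (d := d) Q).biUnion (blockSites L) := by
  ext x
  rw [Finset.mem_biUnion, mem_box_mul_iff_blockMap_mem_box]
  constructor
  · intro h
    exact ⟨blockMap L x, h, (mem_blockSites_iff L _ x).2 rfl⟩
  · rintro ⟨y, hy, hx⟩
    rw [(mem_blockSites_iff L y x).1 hx]
    exact hy

/-- the tiling for `L ∣ P`: `[0,P)ᵈ = ⨆_{y ∈ [0,P∕L)ᵈ} B(y)`. [cite: Balaban1985Averaging, (2)–(3) p.17; Balaban1985RegularSpaces, p.77 («Ω_j = T_η»)] -/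
theorem box_eq_biUnion_blockSites_of_dvd (L : ℕ) [NeZero L] {P : ℕ} (h : L ∣ P) :
    box (d := d) P = (box (d := d) (P / L)).biUnion (blockSites L) := by
  rw [← box_mul_eq_biUnion_blockSites L (P / L), Nat.mul_div_cancel' h]

/-- the tiling one level up: for `Lʲ⁺¹ ∣ P` the level-`j` cell `[0,P∕Lʲ)ᵈ` is tiled by the blocks labelled by the level-`(j+1)` cell `[0,P∕Lʲ⁺¹)ᵈ`.
[cite: Balaban1985Averaging, (2)–(3) p.17; Balaban1985RegularSpaces, p.77] -/
theorem box_div_pow_eq_biUnion_blockSites (L : ℕ) [NeZero L] {P : ℕ} (j : ℕ) (h : L ^ (j + 1) ∣ P) :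
    box (d := d) (P / L ^ j) = (box (d := d) (P / L ^ (j + 1))).biUnion (blockSites L) := by
  have hdiv : L ∣ P / L ^ j := by
    obtain ⟨c, rfl⟩ := h
    refine ⟨c, ?_⟩
    have hLj : 0 < L ^ j := pow_pos (Nat.pos_of_ne_zero (NeZero.ne L)) j
    rw [pow_succ, mul_assoc, Nat.mul_div_cancel_left _ hLj]
  rw [box_eq_biUnion_blockSites_of_dvd L hdiv, Nat.div_div_eq_div_mul, ← pow_succ]

end Tiling

variable {𝔸 : Type*} [CStarAlgebra 𝔸]
variable {V : Type*} [AddCommGroup V] [Module ℝ V]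

/-! ## §2  Block transposes on the cell: `Q′_j(U₀)ᵀ` against `Q′_j(U₀)` over `[0,P)ᵈ` ∕ `[0,P∕Lʲ)ᵈ` -/

section Transposes

variable (B : 𝔸 →ₗ[ℝ] 𝔸 →ₗ[ℝ] V) (S : Subgroup 𝔸ˣ)
variable (L : ℕ) [NeZero L] (U₀ : Site d → Fin d → 𝔸ˣ)

/-- ★ **ONE STEP ON THE CELL: `qprimeT1` IS THE `B`-TRANSPOSE OF THE AVERAGING STEP (3.19)** for a pairing invariant under a subgroup `S` of units containing
the block transporters `T_j(z, y) = Ū₀ʲ(Γ_{z,y})`, and `L ∣ P`: `Σ_{y ∈ [0,P)ᵈ} B(g(y), (Q′ᵀν)(y)) = Σ_{z ∈ [0,P∕L)ᵈ} B((Q′g)(z), ν(z))` — block-local, no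
periodicity needed (the `ℤᵈ` form with finite supports is `B9Eq321LandauOrthogonalZd.finsum_pair_qprimeT1`; n05-a's `B8Eq138LandauZd.sum_pairing_Qprime_eq`
is the all-units `Finset` form over any block family). [cite: Balaban1985BackgroundPropagators, (3.19) p.393; Balaban1985RegularSpaces, (1.29) p.81, p.77 («Ω_j = T_η»)] -/
theorem sum_box_pair_qprimeT1 (hB : ∀ u ∈ S, ∀ a b : 𝔸, B (conjR u a) b = B a (conjR u⁻¹ b)) (j : ℕ)
    (hT : ∀ z y : Site d, bgT L U₀ j z y ∈ S) {P : ℕ} (hP : L ∣ P) (g ν : Site d → 𝔸) :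
    ∑ y ∈ box (d := d) P, B (g y) (qprimeT1 L U₀ j ν y) =
      ∑ z ∈ box (d := d) (P / L), B (Qprime ((zdBlocking d L).B j z) ((zdBlocking d L).wt j z) (bgT L U₀ j z) g) (ν z) := by
  rw [box_eq_biUnion_blockSites_of_dvd (d := d) L hP, Finset.sum_biUnion (pairwiseDisjoint_blockSites L _)]
  refine Finset.sum_congr rfl fun z _ => ?_
  show ∑ y ∈ blockSites L z, B (g y) (qprimeT1 L U₀ j ν y) =
    B (∑ y ∈ blockSites L z, ((L : ℝ) ^ d)⁻¹ • conjR (bgT L U₀ j z y) (g y)) (ν z)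
  rw [map_sum, LinearMap.sum_apply]
  refine Finset.sum_congr rfl fun y hy => ?_
  have hyz : blockMap L y = z := (mem_blockSites_iff L z y).1 hy
  have hinv : B (g y) (conjR (bgT L U₀ j z y)⁻¹ (ν z)) = B (conjR (bgT L U₀ j z y) (g y)) (ν z) := by
    have h := hB (bgT L U₀ j z y) (hT z y) (g y) (ν z)
    exact h.symm
  rw [qprimeT1, hyz, map_smul, LinearMap.map_smul₂, hinv]

/-- ★★ **THE ITERATED TRANSPOSE ON THE CELL: `QprimeT L U₀ j` IS THE `B`-TRANSPOSE OF `Q′_j(U₀)`** = `QprimeIter (zdBlocking d L) (bgT L U₀) j` ((3.19):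
`Q′_j(U) = Q′(Ūʲ⁻¹)⋯Q′(U)`), for `Lʲ ∣ P`: `Σ_{x ∈ [0,P)ᵈ} B(g(x), (Q′_jᵀν)(x)) = Σ_{y ∈ [0,P∕Lʲ)ᵈ} B((Q′_j(U₀)g)(y), ν(y))` — the fine cell against the
level-`j` cell. [cite: Balaban1985BackgroundPropagators, (3.19) p.393; Balaban1985RegularSpaces, (1.29) p.81, p.77 («Ω_j = T_η»)] -/
theorem sum_box_pair_QprimeT (hB : ∀ u ∈ S, ∀ a b : 𝔸, B (conjR u a) b = B a (conjR u⁻¹ b))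
    (hT : ∀ (j : ℕ) (z y : Site d), bgT L U₀ j z y ∈ S) :
    ∀ (j : ℕ) {P : ℕ} (_ : L ^ j ∣ P) (g ν : Site d → 𝔸),
      ∑ x ∈ box (d := d) P, B (g x) (QprimeT L U₀ j ν x) =
        ∑ y ∈ box (d := d) (P / L ^ j), B (QprimeIter (zdBlocking d L) (bgT L U₀) j g y) (ν y) := by
  intro j
  induction j with
  | zero =>
    intro P _ g ν
    simp only [pow_zero, Nat.div_one]
    rfl
  | succ j ih =>
    intro P hP g ν
    have hPj : L ^ j ∣ P := (pow_dvd_pow L (Nat.le_succ j)).trans hP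
    have hdiv : L ∣ P / L ^ j := by
      obtain ⟨c, rfl⟩ := hP
      refine ⟨c, ?_⟩
      have hLj : 0 < L ^ j := pow_pos (Nat.pos_of_ne_zero (NeZero.ne L)) j
      rw [pow_succ, mul_assoc, Nat.mul_div_cancel_left _ hLj]
    show ∑ x ∈ box P, B (g x) (QprimeT L U₀ j (qprimeT1 L U₀ j ν) x) = _
    rw [ih hPj g (qprimeT1 L U₀ j ν), sum_box_pair_qprimeT1 B S L U₀ hB j (hT j) hdiv, Nat.div_div_eq_div_mul, ← pow_succ]
    rfl

/-- **THE LEVEL SUM ON THE CELL**: for `Lᵐ ∣ P`, `Σ_{x∈[0,P)ᵈ} B(g(x), (Q′(U₀)ᵀμ)(x)) = Σ_{j ≤ m} Σ_{y∈[0,P∕Lʲ)ᵈ} B((Q′_j(U₀)g)(y), 𝟙_{Λ_j}(y)μ_j(y))` for the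
multiplier transpose `QT L m Λs U₀ μ` of (1.38)'s record form ((3.24): the levels `j = 0, …, m` summed against the constraint sets `Λ_j`).
[cite: Balaban1985BackgroundPropagators, (3.24) p.394, (3.19) p.393; Balaban1985RegularSpaces, (1.38) p.82] -/
theorem sum_box_pair_QT (hB : ∀ u ∈ S, ∀ a b : 𝔸, B (conjR u a) b = B a (conjR u⁻¹ b))
    (hT : ∀ (j : ℕ) (z y : Site d), bgT L U₀ j z y ∈ S) {m P : ℕ} (hP : L ^ m ∣ P) (g : Site d → 𝔸)
    (Λs : ℕ → Set (Site d)) (μ : ℕ → Site d → 𝔸) :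
    ∑ x ∈ box (d := d) P, B (g x) (QT L m Λs U₀ μ x) =
      ∑ j ∈ Finset.range (m + 1), ∑ y ∈ box (d := d) (P / L ^ j),
        B (QprimeIter (zdBlocking d L) (bgT L U₀) j g y) ((Λs j).indicator (μ j) y) := by
  have h1 : ∀ x, B (g x) (QT L m Λs U₀ μ x) = ∑ j ∈ Finset.range (m + 1), B (g x) (QprimeT L U₀ j ((Λs j).indicator (μ j)) x) := by
    intro x
    simp only [QT, map_sum]
  simp only [h1]
  rw [Finset.sum_comm]
  refine Finset.sum_congr rfl fun j hj => ?_
  have hjm : j ≤ m := Nat.lt_succ_iff.1 (Finset.mem_range.1 hj)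
  exact sum_box_pair_QprimeT B S L U₀ hB hT j ((pow_dvd_pow L hjm).trans hP) g _

end Transposes

/-! ## §3  `Δ^η_{U₀}` on `L²(T_P, ·)`: the quadratic form (3.23) and the `B`-symmetry on periodic data -/

section Laplacian

variable (B : 𝔸 →ₗ[ℝ] 𝔸 →ₗ[ℝ] V) (S : Subgroup 𝔸ˣ)
variable (P : ℕ) [NeZero P] (η : ℝ) (U₀ : Site d → Fin d → 𝔸ˣ)

/-- **The quadratic form of (3.23) on the torus**: `Σ_{x∈[0,P)ᵈ} B(g(x), (Δ^η_{U₀}f)(x)) = Σ_μ Σ_{x∈[0,P)ᵈ} B((D^η_{U₀,μ}g)(x), (D^η_{U₀,μ}f)(x))` for a periodic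
background with bond variables in `S` and periodic `f, g` (`Δ^η_U = D^{η*}_U D^η_U`; dag-n06-b's `sum_box_pair_covDerivFwd` once per direction).
[cite: Balaban1985BackgroundPropagators, (3.23) p.394; Balaban1985RegularSpaces, (1.1) p.76, p.77 («Ω_j = T_η»)] -/
theorem sum_box_pair_covLap_eq_sum (hB : ∀ u ∈ S, ∀ a b : 𝔸, B (conjR u a) b = B a (conjR u⁻¹ b))
    (hUS : ∀ (x : Site d) (μ : Fin d), U₀ x μ ∈ S) (hU : IsPeriodic P U₀) {f g : Site d → 𝔸} (hf : IsPeriodic P f) (hg : IsPeriodic P g) :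
    ∑ x ∈ box (d := d) P, B (g x) (covLap η U₀ f x) =
      ∑ μ : Fin d, ∑ x ∈ box (d := d) P, B (covDerivFwd η U₀ μ g x) (covDerivFwd η U₀ μ f x) := by
  have h1 : ∀ x, B (g x) (covLap η U₀ f x) = ∑ μ : Fin d, B (g x) (covDeriv η U₀ μ (covDerivFwd η U₀ μ f) x) := by
    intro x
    simp only [covLap, covDivB, map_sum]
  simp only [h1]
  rw [Finset.sum_comm]
  refine Finset.sum_congr rfl fun μ _ => ?_
  -- flipped reading of the periodic summation by parts, with the flipped pairing
  have hBf : ∀ u ∈ S, ∀ a b : 𝔸, B.flip (conjR u a) b = B.flip a (conjR u⁻¹ b) := by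
    intro u hu a b
    rw [LinearMap.flip_apply, LinearMap.flip_apply]
    have h := hB u⁻¹ (S.inv_mem hu) b a
    rw [inv_inv] at h
    exact h.symm
  have h := sum_box_pair_covDerivFwd B.flip S P η U₀ hBf μ (fun x => hUS x μ) hU hg
    (B9Eq321LandauProjectionZdPer.isPeriodic_covDerivFwd (η := η) hU hf μ)
  simp only [LinearMap.flip_apply] at h
  exact h.symm

/-- ★ **`Δ^η_{U₀}` IS `B`-SYMMETRIC ON `L²(T_P, ·)`** for every periodic background whose bond variables lie in `S` and periodic `f, g`:
`Σ_{x∈[0,P)ᵈ} B(g(x), (Δ^η_{U₀}f)(x)) = Σ_{x∈[0,P)ᵈ} B((Δ^η_{U₀}g)(x), f(x))` — the pairing by which (3.20)–(3.21) ∕ (1.38) read «R D* A = 0» (the `ℤᵈ`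
form with finite supports is `B9Eq321LandauOrthogonalZd.finsum_pair_covLap_symm`). [cite: Balaban1985BackgroundPropagators, (3.23) p.394, (3.20)–(3.21) p.394; Balaban1985RegularSpaces, p.77] -/
theorem sum_box_pair_covLap_symm (hB : ∀ u ∈ S, ∀ a b : 𝔸, B (conjR u a) b = B a (conjR u⁻¹ b))
    (hUS : ∀ (x : Site d) (μ : Fin d), U₀ x μ ∈ S) (hU : IsPeriodic P U₀) {f g : Site d → 𝔸} (hf : IsPeriodic P f) (hg : IsPeriodic P g) :
    ∑ x ∈ box (d := d) P, B (g x) (covLap η U₀ f x) = ∑ x ∈ box (d := d) P, B (covLap η U₀ g x) (f x) := by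
  rw [sum_box_pair_covLap_eq_sum B S P η U₀ hB hUS hU hf hg]
  have hBf : ∀ u ∈ S, ∀ a b : 𝔸, B.flip (conjR u a) b = B.flip a (conjR u⁻¹ b) := by
    intro u hu a b
    rw [LinearMap.flip_apply, LinearMap.flip_apply]
    have h := hB u⁻¹ (S.inv_mem hu) b a
    rw [inv_inv] at h
    exact h.symm
  have h := sum_box_pair_covLap_eq_sum B.flip S P η U₀ hBf hUS hU hg hf
  simp only [LinearMap.flip_apply] at h
  rw [h]

end Laplacian

/-! ## §4  Multiplier form ⇒ orthogonality form of the Landau condition on the torus -/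

section Landau

variable (B : 𝔸 →ₗ[ℝ] 𝔸 →ₗ[ℝ] V) (S : Subgroup 𝔸ˣ)
variable {P L m : ℕ} [NeZero P] [NeZero L] {η : ℝ} {Λs : ℕ → Set (Site d)} {U₀ : Site d → Fin d → 𝔸ˣ}

/-- ★★ **THE CORE IDENTITY ON THE TORUS (generic multiplier equation).**  Let `B` be a real pairing of the fibre invariant under a subgroup `S` of units
containing the bond variables `U₀(b)` and the block transporters `Ū₀ʲ(Γ_{z,y})` (`bgT`), `U₀` `P`-periodic, `Lᵐ ∣ P`.  If a PERIODIC site function `φ` satisfies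
the multiplier equation `Δ^η_{U₀}φ = Q′(U₀)ᵀμ` on the cell `[0,P)ᵈ` (the common shape of (1.38) with `φ = D^{η*}_{U₀}A`), then for every PERIODIC gauge function
`λ` of `N^per(Q′(U₀))` — `(Q′_j(U₀)λ)(y) = 0` for `y ∈ Λs j`, `j ≤ m` — `Σ_{x∈[0,P)ᵈ} B((Δ^η_{U₀}λ)(x), φ(x)) = 0`.  Proof: move `Δ^η_{U₀}` across (§3), insert the
multiplier equation on the cell, transpose `Q′ᵀ` back onto `λ` cell by cell (§2), and use `Q′_jλ = 0` on `Λ_j`; the multiplier `μ` is never moved, so no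
periodicity of `μ` is needed. [cite: Balaban1985RegularSpaces, (1.38) p.82, p.77 («Ω_j = T_η»); Balaban1985BackgroundPropagators, (3.20)–(3.21) p.394, (3.23)–(3.24) p.394, (3.19) p.393] -/
theorem sum_box_pair_covLap_eq_zero_of_multiplier (hB : ∀ u ∈ S, ∀ a b : 𝔸, B (conjR u a) b = B a (conjR u⁻¹ b))
    (hUS : ∀ (x : Site d) (μ : Fin d), U₀ x μ ∈ S) (hT : ∀ (j : ℕ) (z y : Site d), bgT L U₀ j z y ∈ S) (hU : IsPeriodic P U₀)
    (hP : L ^ m ∣ P) {φ : Site d → 𝔸} (hφ : IsPeriodic P φ)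
    {μ : ℕ → Site d → 𝔸} (hμ : ∀ x ∈ box (d := d) P, covLap η U₀ φ x = QT L m Λs U₀ μ x)
    {lam : Site d → 𝔸} (hlam : IsPeriodic P lam)
    (hQ : ∀ j, j ≤ m → ∀ y ∈ Λs j, QprimeIter (zdBlocking d L) (bgT L U₀) j lam y = 0) :
    ∑ x ∈ box (d := d) P, B (covLap η U₀ lam x) (φ x) = 0 := by
  -- move `Δ^η_{U₀}` to the other side
  rw [← sum_box_pair_covLap_symm B S P η U₀ hB hUS hU hφ hlam]
  -- insert the multiplier equation on the cell
  rw [Finset.sum_congr rfl fun x hx => by rw [hμ x hx], sum_box_pair_QT B S L U₀ hB hT hP lam Λs μ]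
  -- every level vanishes: `Q′_jλ = 0` on `Λ_j`, the multiplier is read on `Λ_j` only
  refine Finset.sum_eq_zero fun j hj => Finset.sum_eq_zero fun y _ => ?_
  have hjm : j ≤ m := Nat.lt_succ_iff.1 (Finset.mem_range.1 hj)
  by_cases hy : y ∈ Λs j
  · rw [hQ j hjm y hy, map_zero, LinearMap.zero_apply]
  · rw [Set.indicator_of_notMem hy, map_zero]

/-- ★★ **MULTIPLIER FORM ⇒ ORTHOGONALITY FORM OF THE LANDAU CONDITION (1.38) ON THE TORUS.**  `B` a real pairing of the fibre invariant under a subgroup `S`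
of units containing the bond variables and the block transporters, `U₀` and `A` `P`-periodic, `Lᵐ ∣ P`.  If `A` satisfies the Landau condition OF RECORD at
`Ω₀ = ℤᵈ` — `IsLandau138 L m η Set.univ Λs U₀ A`: «Δ^η_{U₀}D^{η*}_{U₀}A = Q′(U₀)ᵀμ» (the body N05's `zdGF3 ∕ zdGF3Per` keep at `i.Ω 0 = univ`) — then for every
periodic `λ` with `(Q′_j(U₀)λ)(y) = 0` for `y ∈ Λs j`, `j ≤ m`: `Σ_{x∈[0,P)ᵈ} B((Δ^η_{U₀}λ)(x), (D^{η*}_{U₀}A)(x)) = 0` — `D^{η*}_{U₀}A ⊥_B Δ^η_{U₀}N^per(Q′(U₀))`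
in `L²(T_P, ·)`, i.e. «R(U₀)D^{η*}_{U₀}A = 0» for `R(U₀)` the orthogonal projection onto `Δ^η_{U₀}N^per(Q′(U₀))` ((3.21), `Ω₀ = T_η`).
[cite: Balaban1985RegularSpaces, (1.38) p.82, (1.42) p.83, p.77 («Ω_j = T_η»); Balaban1985BackgroundPropagators, (3.20)–(3.21) p.394, (3.23)–(3.24) p.394, (3.19) p.393] -/
theorem sum_box_pair_covLap_covDivB_eq_zero_of_isLandau138 (hB : ∀ u ∈ S, ∀ a b : 𝔸, B (conjR u a) b = B a (conjR u⁻¹ b))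
    (hUS : ∀ (x : Site d) (μ : Fin d), U₀ x μ ∈ S) (hT : ∀ (j : ℕ) (z y : Site d), bgT L U₀ j z y ∈ S) (hU : IsPeriodic P U₀)
    (hP : L ^ m ∣ P) {A : Site d → Fin d → 𝔸} (hA : IsPeriodic P A) (h : IsLandau138 L m η (Set.univ : Set (Site d)) Λs U₀ A)
    {lam : Site d → 𝔸} (hlam : IsPeriodic P lam)
    (hQ : ∀ j, j ≤ m → ∀ y ∈ Λs j, QprimeIter (zdBlocking d L) (bgT L U₀) j lam y = 0) :
    ∑ x ∈ box (d := d) P, B (covLap η U₀ lam x) (covDivB η U₀ A x) = 0 := by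
  obtain ⟨μ, hμ⟩ := h
  refine sum_box_pair_covLap_eq_zero_of_multiplier B S hB hUS hT hU hP (isPeriodic_covDivB hU hA) (μ := μ) (fun x _ => ?_) hlam hQ
  have hx := hμ x (Set.mem_univ x)
  rwa [Set.indicator_univ] at hx

/-- ★ **COROLLARY — EVERY PERIODIC BACKGROUND OF UNITS** (`S = ⊤`): for a pairing invariant under ALL conjugations `R(u)`, `u ∈ 𝔸ˣ` (e.g. the tracial
pairing `τ(ab)` of p. 391 — `B9Eq321LandauOrthogonalZd.trace_mul_conjR`), the orthogonality form holds at EVERY periodic `U₀ : Site d → Fin d → 𝔸ˣ`, with no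
unitarity hypothesis on `U₀` or on its averages. [cite: Balaban1985RegularSpaces, (1.38) p.82, p.77; Balaban1985BackgroundPropagators, (3.20)–(3.21) p.394] -/
theorem sum_box_pair_covLap_covDivB_eq_zero_of_isLandau138_units (hB : ∀ (u : 𝔸ˣ) (a b : 𝔸), B (conjR u a) b = B a (conjR u⁻¹ b))
    (hU : IsPeriodic P U₀) (hP : L ^ m ∣ P) {A : Site d → Fin d → 𝔸} (hA : IsPeriodic P A)
    (h : IsLandau138 L m η (Set.univ : Set (Site d)) Λs U₀ A) {lam : Site d → 𝔸} (hlam : IsPeriodic P lam)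
    (hQ : ∀ j, j ≤ m → ∀ y ∈ Λs j, QprimeIter (zdBlocking d L) (bgT L U₀) j lam y = 0) :
    ∑ x ∈ box (d := d) P, B (covLap η U₀ lam x) (covDivB η U₀ A x) = 0 :=
  sum_box_pair_covLap_covDivB_eq_zero_of_isLandau138 B ⊤ (fun u _ a b => hB u a b) (fun _ _ => Subgroup.mem_top _)
    (fun _ _ _ => Subgroup.mem_top _) hU hP hA h hlam hQ

/-- ★ **THE ORTHOGONALITY FORM FOR THE TRACIAL PAIRING AT EVERY PERIODIC BACKGROUND OF UNITS**: `τ` tracial (`τ(ab) = τ(ba)`, print's `tr`, p. 391), `U₀, A, λ`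
`P`-periodic, `Lᵐ ∣ P`, `IsLandau138 L m η Set.univ Λs U₀ A`, `Q′_j(U₀)λ = 0` on `Λ_j` (`j ≤ m`) ⟹ `Σ_{x∈[0,P)ᵈ} τ((Δ^η_{U₀}λ)(x)·(D^{η*}_{U₀}A)(x)) = 0` —
«⟨Δ^η_{U₀}λ, D^{η*}_{U₀}A⟩ = 0» in print's pairing `⟨λ, λ′⟩ = Σ_{x∈T_η} η^d tr λ(x)λ′(x)` (the positive weight `η^d` dropped).
[cite: Balaban1985RegularSpaces, (1.38) p.82, p.77; Balaban1985BackgroundPropagators, (3.17) p.393, (3.20)–(3.21) p.394] -/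
theorem sum_box_trace_covLap_mul_covDivB_eq_zero_of_isLandau138 (τ : 𝔸 →ₗ[ℂ] ℂ) (hτ : ∀ a b : 𝔸, τ (a * b) = τ (b * a))
    (hU : IsPeriodic P U₀) (hP : L ^ m ∣ P) {A : Site d → Fin d → 𝔸} (hA : IsPeriodic P A)
    (h : IsLandau138 L m η (Set.univ : Set (Site d)) Λs U₀ A) {lam : Site d → 𝔸} (hlam : IsPeriodic P lam)
    (hQ : ∀ j, j ≤ m → ∀ y ∈ Λs j, QprimeIter (zdBlocking d L) (bgT L U₀) j lam y = 0) :
    ∑ x ∈ box (d := d) P, τ (covLap η U₀ lam x * covDivB η U₀ A x) = 0 := by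
  have key := sum_box_pair_covLap_covDivB_eq_zero_of_isLandau138_units ((LinearMap.mul ℝ 𝔸).compr₂ (τ.restrictScalars ℝ))
    (fun u a b => by simpa using B9Eq321LandauOrthogonalZd.trace_mul_conjR τ hτ u a b) hU hP hA h hlam hQ
  simpa using key

end Landau

/-! ## §5  The Landau condition of record puts `D^{η*}_{U₀}A` in `R(U₀)^⊥` on the torus: `projEPer ∕ projRPer (D^{η*}_{U₀}A) = 0` as equations -/

section Kill

variable {τ : 𝔸 →ₗ[ℂ] ℂ} {P L m : ℕ} [NeZero P] [NeZero L] {η : ℝ} {Λs : ℕ → Set (Site d)} {U₀ : Site d → Fin d → 𝔸ˣ}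

/-- ★★ **`D^{η*}_{U₀}A ∈ R(U₀)^⊥` ON THE TORUS UNDER THE LANDAU CONDITION OF RECORD**: for a tracial `τ` (`τ(ab) = τ(ba)`), a unitary `P`-periodic `U₀`,
`Lᵐ ∣ P` and a periodic `A` with `IsLandau138 L m η Set.univ Λs U₀ A`, every generator `Δ^η_{U₀}λ`, `λ ∈ N_𝔤^per(Q′(U₀))`, is `formPer`-orthogonal to
`D^{η*}_{U₀}A`: by `(Δ^η_{U₀}λ)* = Δ^η_{U₀}λ` (Hermitian `λ`, unitary `U₀`: `B9Eq321LandauProjectionZd.star_covLap_of_isSelfAdjoint`) the pairing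
`Σ_cell Re τ((Δ^η_{U₀}λ)(x)* (D^{η*}_{U₀}A)(x))` is `Re` of §4's tracial identity. [cite: Balaban1985RegularSpaces, (1.38) p.82, p.77 («Ω_j = T_η»); Balaban1985BackgroundPropagators, (3.20)–(3.21) p.394] -/
theorem covDivB_mem_orthogonal_rangeSubPer (hτt : ∀ a b : 𝔸, τ (a * b) = τ (b * a))
    (hUu : ∀ (x : Site d) (κ : Fin d), U₀ x κ ∈ unitaryUnits 𝔸) (hU : IsPeriodic P U₀) (hP : L ^ m ∣ P)
    {A : Site d → Fin d → 𝔸} (hA : IsPeriodic P A) (h : IsLandau138 L m η (Set.univ : Set (Site d)) Λs U₀ A) :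
    (⟨covDivB η U₀ A, isPeriodic_covDivB hU hA⟩ : perSub (𝔸 := 𝔸) (d := d) P) ∈
      (formPer τ P).orthogonal (rangeSubPer P L m η Λs U₀) := by
  rw [LinearMap.BilinForm.mem_orthogonal_iff]
  intro w hw
  -- reduce to the generators: `{w | formPer w f = 0}` is a subspace
  induction hw using Submodule.span_induction with
  | mem w hw =>
    obtain ⟨lam, ⟨hsa, hper, hQ⟩, hwlam⟩ := hw
    show formPer τ P w _ = 0
    rw [formPer_apply]
    have key := sum_box_trace_covLap_mul_covDivB_eq_zero_of_isLandau138 (L := L) τ hτt hU hP hA h hper hQ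
    have hre := congrArg Complex.re key
    rw [Complex.re_sum, Complex.zero_re] at hre
    rw [← hre]
    refine Finset.sum_congr rfl fun x _ => ?_
    rw [hwlam, B9Eq321LandauProjectionZd.star_covLap_of_isSelfAdjoint η hUu hsa]
  | zero =>
    show formPer τ P 0 _ = 0
    rw [map_zero, LinearMap.zero_apply]
  | add w₁ w₂ _ _ h₁ h₂ =>
    show formPer τ P (w₁ + w₂) _ = 0
    have h₁' : formPer τ P w₁ _ = 0 := h₁
    have h₂' : formPer τ P w₂ _ = 0 := h₂
    rw [map_add, LinearMap.add_apply, h₁', h₂', add_zero]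
  | smul c w _ hw =>
    show formPer τ P (c • w) _ = 0
    have hw' : formPer τ P w _ = 0 := hw
    rw [map_smul, LinearMap.smul_apply, hw', smul_zero]

/-- ★★★ **«R(U₀)D^{η*}_{U₀}A = 0» ON THE TORUS AS AN EQUATION FOR THE CONSTRUCTED PROJECTION `projEPer`**: `τ` a faithful Hermitian trace on a
finite-dimensional fibre, `U₀` unitary and `P`-periodic, `Lᵐ ∣ P`, `A` periodic with `IsLandau138 L m η Set.univ Λs U₀ A` ⟹ the orthogonal projection of
`D^{η*}_{U₀}A ∈ L²(T_P, ·)` onto `Δ^η_{U₀}N_𝔤^per(Q′(U₀))` vanishes. [cite: Balaban1985RegularSpaces, (1.38) p.82, (1.42) p.83, p.77; Balaban1985BackgroundPropagators, (3.20)–(3.22) p.394] -/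
theorem projEPer_covDivB_eq_zero_of_isLandau138 [FiniteDimensional ℝ 𝔸] (hτt : ∀ a b : 𝔸, τ (a * b) = τ (b * a))
    (hτs : ∀ a : 𝔸, τ (star a) = starRingEnd ℂ (τ a)) (hτp : ∀ a : 𝔸, a ≠ 0 → 0 < (τ (star a * a)).re)
    (hUu : ∀ (x : Site d) (κ : Fin d), U₀ x κ ∈ unitaryUnits 𝔸) (hU : IsPeriodic P U₀) (hP : L ^ m ∣ P)
    {A : Site d → Fin d → 𝔸} (hA : IsPeriodic P A) (h : IsLandau138 L m η (Set.univ : Set (Site d)) Λs U₀ A) :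
    projEPer τ P L m η Λs U₀ ⟨covDivB η U₀ A, isPeriodic_covDivB hU hA⟩ = 0 :=
  projEPer_apply_of_mem_orthogonal L m η Λs U₀ hτs hτp (covDivB_mem_orthogonal_rangeSubPer hτt hUu hU hP hA h)

/-- ★★★ **«R(U₀)D^{η*}_{U₀}A = 0» ON THE TORUS FOR `projRPer`** (the projection read on all functions `ℤᵈ → 𝔸`: periodise by representatives, project, read
back): under the same hypotheses `projRPer τ P L m η Λs U₀ (D^{η*}_{U₀}A) = 0` — the `hDRDs`-killer the genuine periodic letter `DRDs := D^η_{U₀}·R(U₀)·D^{η*}_{U₀}`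
needs for its `LandauAt`-type binder ([B8] (1.42) «for `A` in the Landau gauge the equation has no `DRD*` term»).
[cite: Balaban1985RegularSpaces, (1.38) p.82, (1.42) p.83, (1.58) p.86, p.77; Balaban1985BackgroundPropagators, (3.20)–(3.22) p.394, (3.26) p.395] -/
theorem projRPer_covDivB_eq_zero_of_isLandau138 [FiniteDimensional ℝ 𝔸] (hτt : ∀ a b : 𝔸, τ (a * b) = τ (b * a))
    (hτs : ∀ a : 𝔸, τ (star a) = starRingEnd ℂ (τ a)) (hτp : ∀ a : 𝔸, a ≠ 0 → 0 < (τ (star a * a)).re)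
    (hUu : ∀ (x : Site d) (κ : Fin d), U₀ x κ ∈ unitaryUnits 𝔸) (hU : IsPeriodic P U₀) (hP : L ^ m ∣ P)
    {A : Site d → Fin d → 𝔸} (hA : IsPeriodic P A) (h : IsLandau138 L m η (Set.univ : Set (Site d)) Λs U₀ A) :
    projRPer τ P L m η Λs U₀ (covDivB η U₀ A) = 0 := by
  have hper : IsPeriodic P (covDivB η U₀ A) := isPeriodic_covDivB hU hA
  have heq : (⟨perRestrict P (covDivB η U₀ A), B9Eq321LandauProjectionZdPer.perRestrict_mem_perSub P _⟩ : perSub (𝔸 := 𝔸) (d := d) P) =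
      ⟨covDivB η U₀ A, hper⟩ := Subtype.ext (perRestrict_eq_self P hper)
  rw [projRPer, heq, projEPer_covDivB_eq_zero_of_isLandau138 hτt hτs hτp hUu hU hP hA h]
  rfl

/-- **THE `DRD*` LETTER VANISHES IDENTICALLY** under the Landau condition of record on the torus: `D^η_{U₀,μ}(R(U₀)D^{η*}_{U₀}A)(x) = 0` at every site and
direction (`D^η_{U₀,μ}0 = 0`). [cite: Balaban1985RegularSpaces, (1.42) p.83, (1.58) p.86; Balaban1985BackgroundPropagators, (3.26) p.395 («D^η_U R(U) D^{η*}_U»)] -/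
theorem covDerivFwd_projRPer_covDivB_eq_zero_of_isLandau138 [FiniteDimensional ℝ 𝔸] (hτt : ∀ a b : 𝔸, τ (a * b) = τ (b * a))
    (hτs : ∀ a : 𝔸, τ (star a) = starRingEnd ℂ (τ a)) (hτp : ∀ a : 𝔸, a ≠ 0 → 0 < (τ (star a * a)).re)
    (hUu : ∀ (x : Site d) (κ : Fin d), U₀ x κ ∈ unitaryUnits 𝔸) (hU : IsPeriodic P U₀) (hP : L ^ m ∣ P)
    {A : Site d → Fin d → 𝔸} (hA : IsPeriodic P A) (h : IsLandau138 L m η (Set.univ : Set (Site d)) Λs U₀ A) (μ : Fin d) (x : Site d) :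
    covDerivFwd η U₀ μ (projRPer τ P L m η Λs U₀ (covDivB η U₀ A)) x = 0 := by
  rw [projRPer_covDivB_eq_zero_of_isLandau138 hτt hτs hτp hUu hU hP hA h]
  exact B8Eq138LandauZd.covDerivFwd_zero_fun η U₀ μ x

end Kill

/-! ## §6  A6 ∕ non-vacuity: the abelian fibre, and an inhabitant of the hypotheses -/

section Witness

variable {P L m : ℕ} [NeZero P] [NeZero L] {η : ℝ} {Λs : ℕ → Set (Site d)}

/-- **A6 ∕ NON-VACUITY OF THE `τ`-HYPOTHESES — THE ABELIAN FIBRE ON THE TORUS**: for `𝔸 = ℂ` (the `U(1)` case) with `τ = id` the three trace properties hold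
(`ab = ba`, `star = conj`, `Re(ā a) = |a|² > 0`), so «R(U₀)D^{η*}_{U₀}A = 0» on `T_P` holds for every unitary periodic `U₀`, every periodic `A` in the Landau gauge
of record, `Lᵐ ∣ P`, with NO hypothesis left. [cite: Balaban1985RegularSpaces, (1.38) p.82, (1.42) p.83; Balaban1985BackgroundPropagators, (3.20)–(3.22) p.394] -/
theorem projRPer_covDivB_eq_zero_of_isLandau138_complex {U₀ : Site d → Fin d → ℂˣ}
    (hUu : ∀ (x : Site d) (κ : Fin d), U₀ x κ ∈ unitaryUnits ℂ) (hU : IsPeriodic P U₀) (hP : L ^ m ∣ P)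
    {A : Site d → Fin d → ℂ} (hA : IsPeriodic P A) (h : IsLandau138 L m η (Set.univ : Set (Site d)) Λs U₀ A) :
    projRPer (LinearMap.id : ℂ →ₗ[ℂ] ℂ) P L m η Λs U₀ (covDivB η U₀ A) = 0 := by
  refine projRPer_covDivB_eq_zero_of_isLandau138 (𝔸 := ℂ) (τ := LinearMap.id) (fun a b => by rw [mul_comm]) (fun a => rfl)
    (fun a ha => ?_) hUu hU hP hA h
  rw [LinearMap.id_apply, Complex.star_def, ← Complex.normSq_eq_conj_mul_self, Complex.ofReal_re]
  exact Complex.normSq_pos.2 ha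

omit [NeZero P] [NeZero L] in
/-- **THE HYPOTHESES OF §5 ARE JOINTLY INHABITED**: at ANY background `U₀` the zero field `A = 0` is periodic and satisfies the Landau condition of record at
`Ω₀ = ℤᵈ` (`B8Eq138LandauZd.isLandau138_zero`, multiplier `μ = 0`); with the constant background `U₀ ≡ 1` (periodic, unitary) and `P = Lᵐ` every hypothesis of
`projRPer_covDivB_eq_zero_of_isLandau138` holds. [cite: Balaban1985RegularSpaces, (1.38) p.82 (the trivial solution); Balaban1985BackgroundPropagators, (3.20) p.394] -/
theorem isLandau138_univ_zero_periodic (U₀ : Site d → Fin d → 𝔸ˣ) :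
    IsPeriodic P (0 : Site d → Fin d → 𝔸) ∧ IsLandau138 L m η (Set.univ : Set (Site d)) Λs U₀ (0 : Site d → Fin d → 𝔸) :=
  ⟨fun _ _ => rfl, B8Eq138LandauZd.isLandau138_zero η L U₀ m Set.univ Λs⟩

omit [NeZero P] [NeZero L] in
/-- **A NON-ZERO INHABITANT AT THE FLAT BACKGROUND**: a CONSTANT bond field `A ≡ v` is periodic and co-closed at `U₀ = 1` (`D^{η*}_1A = 0`), hence in the Landau
gauge of record at `Ω₀ = ℤᵈ` with the zero multiplier — for `v ≠ 0` a non-zero field on which §5 bites (and `U₀ ≡ 1` is periodic and unitary).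
[cite: Balaban1985RegularSpaces, (1.38) p.82; Balaban1984PropagatorsI, (1.72) p.30 («A₀ is a constant vector function»)] -/
theorem isLandau138_univ_const_one (v : 𝔸) :
    IsPeriodic P (fun (_ : Site d) (_ : Fin d) => v) ∧
      IsLandau138 L m η (Set.univ : Set (Site d)) Λs (1 : Site d → Fin d → 𝔸ˣ) (fun _ _ => v) := by
  refine ⟨fun _ _ => rfl, fun _ _ => 0, fun x _ => ?_⟩
  have h0 : covDivB η (1 : Site d → Fin d → 𝔸ˣ) (fun _ _ => v) = 0 := by
    funext z
    simp [covDivB, covDeriv, conjR]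
  rw [Set.indicator_univ, h0, B8Eq138LandauZd.covLap_zero, B8Eq138LandauZd.QT_zero]

end Witness

end Literature.MathematicalPhysics.QuantumFieldTheory.Balaban1983to89.B9Eq321LandauOrthogonalZdPer

end
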